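import Literature.NumberTheory.Automorphic.UnitaryGroupOrbitalMeasureFamilyOfLocal
import HarnessLib

/-!
# `AdelicOrbitalMeasureFamily.ofLocal` depends on the local families only through their members AT THE CLASS
(Rogawski (1990), §5.4 pp. 71–72; Gelbart (1975), (9.13))

Topic `NumberTheory/Automorphic`; namespace `Literature.NumberTheory.Automorphic.UnitaryGroup`; THEOREMS ONLY (no definition, no instance, no named fact,
no `sorry`).  Cell `pub/hodgecm-mathlib`, ENGINE T1 line `F0_T1InnerFormTraceIdentity` (crux item stmt-HodgeConjecture-24833), row (A-s) ∕ RULING #115 (F1′):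
the ED 1.24 anchor PATCHES the kit's class-indexed local families (`mG′ v c := if IsRegularElt (out c) then mG v c else mG_s v c`, idem at `∞`), and the
singular-class package letter (K7-s) is stated for the singular members `mG_s`; this file is the bridge: at a rational class `c`, ★
`AdelicOrbitalMeasureFamily.ofLocal L N H mG mGi c` reads `mG v` only at the local class `⟦(γ_c)_v⟧` and `mGi` only at `⟦(γ_c)_∞⟧` (`γ_c = out c`), so two
pairs of families with the SAME members there (admissible, normalised off some finite set) have the SAME `ofLocal` at `c` (★ `ofLocal_eq`: independence of the
exceptional set).

* **`UnitaryGroup.AdelicOrbitalMeasureFamily.ofLocal_congr`**.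
HC_CM is proved only modulo the printed citations until rung 0 closes; this file proves no printed citation.

## References
* J. D. Rogawski, *Automorphic Representations of Unitary Groups in Three Variables* (1990), §5.4 pp. 71–72 [Rogawski1990].
* S. Gelbart, *Automorphic forms on adele groups* (1975), (9.13), p. 155 (10.19) [Gelbart1975].
-/

set_option autoImplicit false

noncomputable section

open MeasureTheory Measure Set Topology NumberField IsDedekindDomain
open Literature.MeasureTheory.Group

namespace Literature.NumberTheory.Automorphic

namespace UnitaryGroup

variable (L : Type) [Field L] [NumberField L] [IsCMField L] (N : ℕ) (H : Matrix (Fin N) (Fin N) L)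
  [∀ g : (cmDatum L N H).Adelic, MeasurableSpace ((cmDatum L N H).Adelic ⧸ Subgroup.centralizer ({g} : Set (cmDatum L N H).Adelic))]
  [∀ a : arch (↥(maximalRealSubfield L)) L (IsCMField.complexConj L) N H,
    MeasurableSpace (arch (↥(maximalRealSubfield L)) L (IsCMField.complexConj L) N H ⧸
      Subgroup.centralizer ({a} : Set (arch (↥(maximalRealSubfield L)) L (IsCMField.complexConj L) N H)))]
  [∀ (v : HeightOneSpectrum (𝓞 ↥(maximalRealSubfield L))) (x : (cmDatum L N H).Local v),
    MeasurableSpace ((cmDatum L N H).Local v ⧸ Subgroup.centralizer ({x} : Set ((cmDatum L N H).Local v)))]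
  [∀ (v : HeightOneSpectrum (𝓞 ↥(maximalRealSubfield L))) (x : (cmDatum L N H).Local v),
    BorelSpace ((cmDatum L N H).Local v ⧸ Subgroup.centralizer ({x} : Set ((cmDatum L N H).Local v)))]
  (mG mG' : ∀ v : HeightOneSpectrum (𝓞 ↥(maximalRealSubfield L)), OrbitalMeasureFamily ((cmDatum L N H).Local v))
  (mGi mGi' : OrbitalMeasureFamily (arch (↥(maximalRealSubfield L)) L (IsCMField.complexConj L) N H))
  (c : ConjClasses (cmDatum L N H).Rational)

/-- **`ofLocal` at `c` depends on the families only through their members at `⟦(γ_c)_v⟧`, `⟦(γ_c)_∞⟧`** (`γ_c = out c`): if `mG v` and `mG′ v` have the same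
member at the local class of `(γ_c)_v` for every `v`, `mGi` and `mGi′` the same member at the archimedean class of `(γ_c)_∞`, and those members of `mG` are
admissible and normalised at `γ_c ⊗ 1` off a finite set `S₀`, then `ofLocal mG mGi c = ofLocal mG′ mGi′ c` (both are ★ `adelicOrbitalMeasureOfLocal` at the
common point data and the common exceptional set, ★ `ofLocal_eq`). [cite: Rogawski1990, §5.4 p. 72] [cite: Gelbart1975, (9.13)] -/
theorem AdelicOrbitalMeasureFamily.ofLocal_congr {S₀ : Finset (HeightOneSpectrum (𝓞 ↥(maximalRealSubfield L)))}
    (hS₀ : IsNormalisedOff L N H mG ((cmDatum L N H).toAdelic (Quotient.out c)) S₀)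
    (hadm : ∀ v, mG v (ConjClasses.mk ((cmDatum L N H).toLocal v ((cmDatum L N H).toAdelic (Quotient.out c)))) ≠ 0 ∧
      SMulInvariantMeasure ((cmDatum L N H).Local v) _ (mG v (ConjClasses.mk ((cmDatum L N H).toLocal v ((cmDatum L N H).toAdelic (Quotient.out c))))) ∧
      IsFiniteMeasureOnCompacts (mG v (ConjClasses.mk ((cmDatum L N H).toLocal v ((cmDatum L N H).toAdelic (Quotient.out c))))))
    (hG : ∀ v, mG v (ConjClasses.mk ((cmDatum L N H).toLocal v ((cmDatum L N H).toAdelic (Quotient.out c)))) =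
      mG' v (ConjClasses.mk ((cmDatum L N H).toLocal v ((cmDatum L N H).toAdelic (Quotient.out c)))))
    (hGi : mGi (ConjClasses.mk (archPart (↥(maximalRealSubfield L)) L (IsCMField.complexConj L) N H ((cmDatum L N H).toAdelic (Quotient.out c)))) =
      mGi' (ConjClasses.mk (archPart (↥(maximalRealSubfield L)) L (IsCMField.complexConj L) N H ((cmDatum L N H).toAdelic (Quotient.out c))))) :
    AdelicOrbitalMeasureFamily.ofLocal L N H mG mGi c = AdelicOrbitalMeasureFamily.ofLocal L N H mG' mGi' c := by
  have hpt : ∀ v, (mG' v).atPoint ((cmDatum L N H).toLocal v ((cmDatum L N H).toAdelic (Quotient.out c))) =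
      (mG v).atPoint ((cmDatum L N H).toLocal v ((cmDatum L N H).toAdelic (Quotient.out c))) := fun v => by
    unfold OrbitalMeasureFamily.atPoint
    rw [hG v]
  have hpti : mGi'.atPoint (archPart (↥(maximalRealSubfield L)) L (IsCMField.complexConj L) N H ((cmDatum L N H).toAdelic (Quotient.out c))) =
      mGi.atPoint (archPart (↥(maximalRealSubfield L)) L (IsCMField.complexConj L) N H ((cmDatum L N H).toAdelic (Quotient.out c))) := by
    unfold OrbitalMeasureFamily.atPoint
    rw [hGi]
  have hS₀' : IsNormalisedOff L N H mG' ((cmDatum L N H).toAdelic (Quotient.out c)) S₀ := fun v hv => by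
    rw [hpt v]
    exact hS₀ v hv
  have hadm' : ∀ v, mG' v (ConjClasses.mk ((cmDatum L N H).toLocal v ((cmDatum L N H).toAdelic (Quotient.out c)))) ≠ 0 ∧
      SMulInvariantMeasure ((cmDatum L N H).Local v) _ (mG' v (ConjClasses.mk ((cmDatum L N H).toLocal v ((cmDatum L N H).toAdelic (Quotient.out c))))) ∧
      IsFiniteMeasureOnCompacts (mG' v (ConjClasses.mk ((cmDatum L N H).toLocal v ((cmDatum L N H).toAdelic (Quotient.out c))))) := fun v => by
    rw [← hG v]
    exact hadm v
  rw [AdelicOrbitalMeasureFamily.ofLocal_eq L N H mG mGi c hS₀ hadm, AdelicOrbitalMeasureFamily.ofLocal_eq L N H mG' mGi' c hS₀' hadm']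
  simp only [hpt, hpti]

end UnitaryGroup

end Literature.NumberTheory.Automorphic
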